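import Summits.AtomisticToContinuum.BoseEinsteinCondensation.Theses.BECConjugateDomination
import Literature.MathematicalPhysics.QuantumManyBody.PeriodicKineticBudget
import Literature.MathematicalPhysics.QuantumManyBody.BogoliubovSpectrumGP
import HarnessLib

/-!
# (β') from the gap of the limit potential and the truncation convergence of the Ky Fan two-sum
# — line `third-law-current-floor`, crux `HardCoreExtension` (stmt-AtomisticToContinuum-11786), lead c1

Structure lemma for the alternative skeleton: at a fixed `(N, L)`, a Ky Fan gap `2E₀(v) + γ ≤ K₂(v)` of the potential `v`
itself (v3.2's S5'' shape) together with the truncation convergence of the Ky Fan two-sum from below,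
`K₂(v) ≤ K₂(min(v,n)) + γ/2` for all large `n` (an (α')-type statement for orthogonal pairs, "(α'₂)"), gives the gap
`2E₀(min(v,n)) + γ/2 ≤ K₂(min(v,n))` of the truncations UNIFORMLY in `n ≥ n₀` — the input (β') of the landed transfer
`stub_truncationTransferOfUniformGap`. Only `E₀(min(v,n)) ≤ E₀(v)` (monotonicity) and `ℝ≥0∞` arithmetic are used. [folklore]
-/

noncomputable section

namespace Summit.AtomisticToContinuum.BoseEinsteinCondensation.Cruxes.HardCoreExtension.ThirdLawCurrentFloor

open MeasureTheory Filter
open scoped ENNReal NNReal BigOperators Topology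
open Literature.MathematicalPhysics.QuantumManyBody.BoseGas

/-- **(β') ⇐ gap of `v` + (α'₂)** (registered `stub_truncationGapOfLimitGap`): see the module docstring. [folklore] -/
theorem stub_truncationGapOfLimitGap :
    ∀ (v : ℝ → ℝ≥0∞) (N : ℕ) (L : ℝ) (γ : ℝ), 0 < γ →
      2 * periodicGroundStateEnergy v N L + ENNReal.ofReal γ ≤ kyFanTwo v N L →
      (∃ n₀ : ℕ, ∀ n : ℕ, n₀ ≤ n →
        kyFanTwo v N L ≤ kyFanTwo (fun r => min (v r) (n : ℝ≥0∞)) N L + ENNReal.ofReal (γ / 2)) →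
      ∃ n₀ : ℕ, ∀ n : ℕ, n₀ ≤ n →
        2 * periodicGroundStateEnergy (fun r => min (v r) (n : ℝ≥0∞)) N L + ENNReal.ofReal (γ / 2) ≤
          kyFanTwo (fun r => min (v r) (n : ℝ≥0∞)) N L := by
  intro v N L γ hγ hgap hconv
  obtain ⟨n₀, hn₀⟩ := hconv
  refine ⟨n₀, fun n hn => ?_⟩
  have hKn := hn₀ n hn
  -- monotonicity of the ground-state energy in the potential
  have hmono : periodicGroundStateEnergy (fun r => min (v r) (n : ℝ≥0∞)) N L ≤ periodicGroundStateEnergy v N L :=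
    periodicGroundStateEnergy_mono_of_le fun r => min_le_left _ _
  have hγsplit : ENNReal.ofReal γ = ENNReal.ofReal (γ / 2) + ENNReal.ofReal (γ / 2) := by
    rw [← ENNReal.ofReal_add (by positivity) (by positivity)]; congr 1; ring
  -- `2E₀(vₙ) + γ/2 + γ/2 ≤ 2E₀(v) + γ ≤ K₂(v) ≤ K₂(vₙ) + γ/2`
  have hchain : 2 * periodicGroundStateEnergy (fun r => min (v r) (n : ℝ≥0∞)) N L + ENNReal.ofReal (γ / 2) +
      ENNReal.ofReal (γ / 2) ≤ kyFanTwo (fun r => min (v r) (n : ℝ≥0∞)) N L + ENNReal.ofReal (γ / 2) :=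
    calc 2 * periodicGroundStateEnergy (fun r => min (v r) (n : ℝ≥0∞)) N L + ENNReal.ofReal (γ / 2) +
          ENNReal.ofReal (γ / 2)
        ≤ 2 * periodicGroundStateEnergy v N L + ENNReal.ofReal γ := by
          rw [hγsplit, ← add_assoc]
          gcongr
      _ ≤ kyFanTwo v N L := hgap
      _ ≤ _ := hKn
  exact (ENNReal.add_le_add_iff_right ENNReal.ofReal_ne_top).1 hchain

end Summit.AtomisticToContinuum.BoseEinsteinCondensation.Cruxes.HardCoreExtension.ThirdLawCurrentFloor

end
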